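import Literature.Probability.Percolation.VoronoiSeparating
import Literature.Probability.Percolation.VoronoiArmEstimates
import Literature.Probability.Percolation.SmirnovContinuumLimit
import Literature.Probability.Percolation.QuadCrossingSquareModel
import Literature.Probability.RandomPlanarGeometry.MarkedDomainCorners
import Literature.Topology.PlaneTopology.PlusCrossing
import Literature.Topology.PlaneTopology.JordanDomainLocalJoin
import HarnessLib

/-!
# Stub `stub_voronoiCorner` of line `Sketch` (crux `Target`, stmt-CriticalPhenomena-6431)

Bollobás–Riordan's relation (40) at the corner `z = P₄` (*Percolation* (2006), Ch. 7, p. 201 and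
pp. 202–203) for annealed Poisson–Voronoi percolation, FROM Tassion's one-arm estimate
`VoronoiAnnealedOneArm` (F1, named fact of `VoronoiArmEstimates.lean`), in ∀-sequence form: for a
conformal rectangle `R = (Ω; a', b', c', d')`, the `3`-marked domain `D = forgetLast R` (arcs
`A₀ = R.arc 0`, `A₁ = R.arc 1`, `A₂ = R.arc 2 ∪ R.arc 3`) and every family `z_δ → d' = R.pt 3` of
points of `closure Ω`,
`P[black crossing R.arc 0 ↔ R.arc 2 in closure Ω] - f_δ¹(z_δ) → 0` as `δ → 0⁺`, where
`f_δ¹ = voronoiSepProb (PB.prod PW) D δ 1` is the annealed probability of the separating event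
`E¹` (a black `A₂`–`A₀` path in `closure Ω` cutting the point from `A₁`).

Proof.  Let `ρ > 0` be smaller than the distance from `d'` to `R.arc 0` (`d' ∉ R.arc 0`,
`MarkedDomain.pt_mem_arc_iff`).  Given `β > 0`, F1 (`VoronoiAnnealedOneArm.exists_radius`) gives
`ε ∈ (0, ρ)` such that the arm event `N` = "a black path from `B̄(d', ε)` to `{dist · d' ≥ ρ}`"
has probability `≤ β/2` for all small `δ`; uniform local path-connectedness of `closure Ω`
(`exists_joinedIn_closure_ball`) joins `z_δ`, once close to `d'`, to `d'` by a path `τ` inside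
`closure Ω ∩ B(d', ε)`.  Then, deterministically (`corner_crossing_imp`, `corner_sepEvent_imp`):
* `V ⊆ E ∪ N`: a black crossing `γ` from `R.arc 2` to `R.arc 0` meeting `B(d', ε)` contains an
  arm (its endpoint on `R.arc 0` is `ρ`-far from `d'`); one missing `B(d', ε) ⊇ range τ ∋ z_δ`
  cuts `z_δ` from `R.arc 1`, for a path from `z_δ` to `R.arc 1` off `γ`, prefixed by `τ`, would
  join `R.arc 3 ∋ d'` to `R.arc 1` in `closure Ω` without meeting the `R.arc 2`–`R.arc 0` path
  `γ` — impossible by the INTERLACING LEMMA `ConformalRectangle.inter_nonempty_of_interlaced`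
  (two continua in `closure Ω` joining opposite pairs of sides meet: read through a square model
  `Φ` of `R`, `exists_isSquareModel`, this is `inter_nonempty_of_plus_chart`).
* `E ⊆ V ∪ N`: a black `A₂`–`A₀` path `γ` cutting `z_δ` from `A₁` either meets `R.arc 2` — its
  sub-path from `R.arc 0` to that point is a crossing — or misses `R.arc 2`; then either it meets
  `B(d', ε)` (an arm, as before) or `R.arc 2` traversed from `d'` back to `R.pt 2 ∈ R.arc 1`,
  prefixed by `τ` reversed, joins `z_δ` to `A₁` off `γ` — contradicting the cut.
Hence `|P V - f_δ¹(z_δ)| ≤ P N ≤ β/2 < β` eventually (`measureReal_mono`, `measureReal_union_le`).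
-/

noncomputable section

namespace Summit.CriticalPhenomena.CardyFormulaZ2.Theorems.CardyFlipRussoTarget

open MeasureTheory Filter Set Metric
open scoped Topology
open Literature.Analysis.FunctionSpaces
open Literature.Probability.RandomPlanarGeometry
open Literature.Probability.RandomPlanarGeometry.MarkedDomain (forgetLast)
open Literature.Probability.LatticeModels
open Literature.Probability.Percolation
open Literature.Topology.PlaneTopology

/-! ### The interlacing lemma for a conformal rectangle -/

/-- **Interlacing lemma.**  In the closure of a conformal rectangle `R`, a compact connected set
`K` meeting the arcs `R.arc 0` and `R.arc 2` and a compact connected set `L` meeting the arcs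
`R.arc 1` and `R.arc 3` intersect: through a square model `Φ` of `R` (`exists_isSquareModel`:
`Φ` maps `[-1, 1]²` onto `closure Ω` and side `k` onto `R.arc k`) the pull-backs are in plus
position in the square, `inter_nonempty_of_plus_chart` (Bollobás–Riordan, Ch. 7, proof of
Claim 19, p. 192: "a horizontal crossing and a vertical crossing must meet"). -/
theorem ConformalRectangle.inter_nonempty_of_interlaced (R : ConformalRectangle) {K L : Set ℂ}
    (hK : IsCompact K) (hKc : IsPreconnected K) (hKsub : K ⊆ closure R.carrier)
    (hK0 : (K ∩ R.arc 0).Nonempty) (hK2 : (K ∩ R.arc 2).Nonempty)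
    (hL : IsCompact L) (hLc : IsPreconnected L) (hLsub : L ⊆ closure R.carrier)
    (hL1 : (L ∩ R.arc 1).Nonempty) (hL3 : (L ∩ R.arc 3).Nonempty) : (K ∩ L).Nonempty := by
  obtain ⟨Φ, hΦ⟩ := exists_isSquareModel R
  have hcl : ∀ p ∈ closure R.carrier, Φ.symm p ∈ Icc (-1 : ℝ) 1 ×ℂ Icc (-1 : ℝ) 1 := by
    intro p hp
    rw [← hΦ.image_Icc] at hp
    obtain ⟨q, hq, rfl⟩ := hp
    rwa [Φ.symm_apply_apply]
  have harc : ∀ k, ∀ p ∈ R.arc k, Φ.symm p ∈ unitSquareQuad.arc k := by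
    intro k p hp
    rw [← hΦ.image_arc k] at hp
    obtain ⟨q, hq, rfl⟩ := hp
    rwa [Φ.symm_apply_apply]
  refine inter_nonempty_of_plus_chart Φ (a := -1) (b := 1) (c := -1) (d := 1) (by norm_num)
    (by norm_num) hK hKc (fun p hp => ?_) ?_ ?_ hL hLc (fun p hp => ?_) ?_ ?_
  · have h := (Complex.mem_reProdIm.1 (hcl p (hKsub hp))).1
    exact ⟨h.1, h.2⟩
  · obtain ⟨p, hpK, hp0⟩ := hK0
    exact ⟨p, hpK, (SquareModel.mem_arc_zero.1 (harc 0 p hp0)).1.le⟩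
  · obtain ⟨p, hpK, hp2⟩ := hK2
    exact ⟨p, hpK, (SquareModel.mem_arc_two.1 (harc 2 p hp2)).1.ge⟩
  · have h := (Complex.mem_reProdIm.1 (hcl p (hLsub hp))).2
    exact ⟨h.1, h.2⟩
  · obtain ⟨p, hpL, hp3⟩ := hL3
    exact ⟨p, hpL, (SquareModel.mem_arc_three.1 (harc 3 p hp3)).1.le⟩
  · obtain ⟨p, hpL, hp1⟩ := hL1
    exact ⟨p, hpL, (SquareModel.mem_arc_one.1 (harc 1 p hp1)).1.ge⟩

/-! ### The two deterministic inclusions at the corner `d' = R.pt 3` -/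

/-- A join inside `closure Ω ∩ B(d', ε)` avoids every path missing the ball `B(d', ε)`, so it is
a join in `closure Ω` off that path. -/
theorem joinedIn_diff_of_forall_notMem_ball {X : Set ℂ} {d z : ℂ} {ε : ℝ} {x y : ℂ}
    (γ : Path x y) (hno : ¬ ∃ t, γ t ∈ ball d ε) (hτ : JoinedIn (X ∩ ball d ε) d z) :
    JoinedIn (X \ range γ) d z := by
  refine hτ.mono ?_
  rintro p ⟨hp, hpd⟩
  refine ⟨hp, ?_⟩
  rintro ⟨t, rfl⟩
  exact hno ⟨t, hpd⟩

/-- A sub-path of a black path from a time `t` with `γ t ∈ B(d', ε)` to an endpoint `ρ`-far from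
`d'` is a black arm at `d'`. -/
theorem corner_arm_of_mem_ball {δ ε ρ : ℝ} {d x y : ℂ} {B W : Set ℂ} (γ : Path x y)
    (hγ : ∀ t, (γ t : ℂ) / (δ : ℂ) ∈ blackRegion B W) {t : unitInterval}
    (ht : γ t ∈ ball d ε) (hy : ρ ≤ dist y d) :
    ∃ (a b : ℂ) (γ' : Path a b), dist a d ≤ ε ∧ ρ ≤ dist b d ∧
      ∀ s, (γ' s : ℂ) / (δ : ℂ) ∈ blackRegion B W := by
  obtain ⟨a, b, γ', ha, hb, hsub⟩ := exists_subpath γ t 1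
  refine ⟨a, b, γ', by rw [ha]; exact (mem_ball.1 ht).le, by rw [hb, γ.target]; exact hy,
    fun s => ?_⟩
  obtain ⟨u, hu⟩ := hsub ⟨s, rfl⟩
  rw [← hu]
  exact hγ u

/-- **`V ⊆ E¹(z') ∪ N`** (Bollobás–Riordan, pp. 202–203, first inclusion of (40) at the corner):
if `z'` is joined to `d' = R.pt 3` inside `closure Ω ∩ B(d', ε)` and `R.arc 0` is `ρ`-far from
`d'`, a black crossing of `closure Ω` from `R.arc 0` to `R.arc 2` either contains a black arm from
`B̄(d', ε)` to `{dist · d' ≥ ρ}` or, reversed, is a black `A₂`–`A₀` path of `forgetLast R`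
cutting `z'` from `A₁ = R.arc 1` (interlacing lemma). -/
theorem corner_crossing_imp {R : ConformalRectangle} {δ ε ρ : ℝ} {z' : ℂ} {B W : Set ℂ}
    (hfar : ∀ x ∈ R.arc 0, ρ ≤ dist x (R.pt 3))
    (hτ : JoinedIn (closure R.carrier ∩ ball (R.pt 3) ε) (R.pt 3) z')
    (hV : voronoiCrossing R.carrier (R.arc 0) (R.arc 2) δ B W) :
    voronoiSepEvent (forgetLast R) δ 1 z' B W ∨
      ∃ (a b : ℂ) (γ : Path a b), dist a (R.pt 3) ≤ ε ∧ ρ ≤ dist b (R.pt 3) ∧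
        ∀ t, (γ t : ℂ) / (δ : ℂ) ∈ blackRegion B W := by
  obtain ⟨x₀, hx₀, y₀, hy₀, hJ⟩ := hV
  set γ : Path y₀ x₀ := hJ.somePath.symm with hγdef
  have hγ : ∀ t, γ t ∈ closure R.carrier ∩ {w | w / (δ : ℂ) ∈ blackRegion B W} := fun t => by
    rw [hγdef, Path.symm_apply]
    exact hJ.somePath_mem _
  by_cases hnear : ∃ t, γ t ∈ ball (R.pt 3) ε
  · obtain ⟨t, ht⟩ := hnear
    exact Or.inr (corner_arm_of_mem_ball γ (fun t => (hγ t).2) ht (hfar x₀ hx₀))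
  refine Or.inl ⟨y₀, ?_, x₀, ?_, γ, hγ, ?_, ?_⟩
  · show y₀ ∈ (forgetLast R).arc 2
    rw [MarkedDomain.forgetLast_arc_two]
    exact Or.inl hy₀
  · show x₀ ∈ R.arc 0
    exact hx₀
  · -- `z'`, the endpoint of `τ`, lies in the ball missed by `γ`
    rintro ⟨t, ht⟩
    exact hnear ⟨t, by rw [ht]; exact hτ.target_mem.2⟩
  · -- no point of `R.arc 1` is joined to `z'` off `γ` (interlacing)
    intro a ha hσ
    have hda : JoinedIn (closure R.carrier \ range γ) (R.pt 3) a :=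
      (joinedIn_diff_of_forall_notMem_ball γ hnear hτ).trans hσ
    set L : Set ℂ := range hda.somePath with hL
    have hLsub : L ⊆ closure R.carrier \ range γ := by
      rintro _ ⟨s, rfl⟩
      exact hda.somePath_mem s
    obtain ⟨p, hpK, hpL⟩ := ConformalRectangle.inter_nonempty_of_interlaced R
      (isCompact_range γ.continuous) (isConnected_range γ.continuous).isPreconnected
      (fun _ ⟨t, ht⟩ => ht ▸ (hγ t).1) ⟨x₀, ⟨1, γ.target⟩, hx₀⟩ ⟨y₀, ⟨0, γ.source⟩, hy₀⟩
      (isCompact_range hda.somePath.continuous)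
      (isConnected_range hda.somePath.continuous).isPreconnected (fun q hq => (hLsub hq).1)
      ⟨a, ⟨1, hda.somePath.target⟩, ha⟩ ⟨R.pt 3, ⟨0, hda.somePath.source⟩, R.pt_mem_arc_self 3⟩
    exact (hLsub hpL).2 hpK

/-- **`E¹(z') ⊆ V ∪ N`** (Bollobás–Riordan, pp. 202–203, second inclusion of (40) at the
corner): under the same hypotheses, a black `A₂`–`A₀` path `γ` of `forgetLast R` cutting `z'` from
`A₁` either meets `R.arc 2` — its final piece from `R.arc 0` back to `R.arc 2` is a black crossing —
or contains a black arm at `d'`; for if it missed both `R.arc 2` and `B(d', ε)`, the arc `R.arc 2`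
run from `d'` to `R.pt 2 ∈ R.arc 1`, prefixed by the join of `z'` to `d'`, would join `z'` to `A₁`
off `γ`. -/
theorem corner_sepEvent_imp {R : ConformalRectangle} {δ ε ρ : ℝ} {z' : ℂ} {B W : Set ℂ}
    (hfar : ∀ x ∈ R.arc 0, ρ ≤ dist x (R.pt 3))
    (hτ : JoinedIn (closure R.carrier ∩ ball (R.pt 3) ε) (R.pt 3) z')
    (hE : voronoiSepEvent (forgetLast R) δ 1 z' B W) :
    voronoiCrossing R.carrier (R.arc 0) (R.arc 2) δ B W ∨
      ∃ (a b : ℂ) (γ : Path a b), dist a (R.pt 3) ≤ ε ∧ ρ ≤ dist b (R.pt 3) ∧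
        ∀ t, (γ t : ℂ) / (δ : ℂ) ∈ blackRegion B W := by
  obtain ⟨x, -, y, hy, γ, hγ, hcut⟩ := hE
  have hy' : y ∈ R.arc 0 := hy
  by_cases h2 : ∃ t, γ t ∈ R.arc 2
  · -- the final piece of `γ`, from `y ∈ R.arc 0` back to a point of `R.arc 2`, is a crossing
    obtain ⟨t, ht⟩ := h2
    obtain ⟨a, b, γ', ha, hb, hsub⟩ := exists_subpath γ 1 t
    have hJ : JoinedIn (closure R.carrier ∩ {w | w / (δ : ℂ) ∈ blackRegion B W}) a b := by
      refine ⟨γ', fun s => ?_⟩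
      obtain ⟨u, hu⟩ := hsub ⟨s, rfl⟩
      rw [← hu]
      exact hγ u
    rw [ha, hb, γ.target] at hJ
    exact Or.inl ⟨y, hy', γ t, ht, hJ⟩
  by_cases hnear : ∃ t, γ t ∈ ball (R.pt 3) ε
  · obtain ⟨t, ht⟩ := hnear
    exact Or.inr (corner_arm_of_mem_ball γ (fun t => (hγ t).2) ht (hfar y hy'))
  -- otherwise `z'` is joined to `R.pt 2 ∈ A₁` off `γ`: contradiction with the cut
  exfalso
  have h23 : JoinedIn (R.arc 2) (R.pt 2) (R.pt 3) :=
    (((convex_Icc (R.mark 2) (R.nextMark 2)).isPathConnected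
      (nonempty_Icc.2 (R.mark_lt_nextMark 2).le)).image R.continuous_boundary).joinedIn
      (R.pt 2) (R.pt_mem_arc_self 2) (R.pt 3) (R.pt_succ_mem_arc 2)
  have h23' : JoinedIn (closure R.carrier \ range γ) (R.pt 2) (R.pt 3) := by
    refine h23.mono fun p hp => ⟨frontier_subset_closure (R.arc_subset_frontier 2 hp), ?_⟩
    rintro ⟨u, rfl⟩
    exact h2 ⟨u, hp⟩
  have hz2 : JoinedIn (closure R.carrier \ range γ) z' (R.pt 2) :=
    (joinedIn_diff_of_forall_notMem_ball γ hnear hτ).symm.trans h23'.symm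
  exact hcut.2 (R.pt 2) (R.pt_succ_mem_arc 1) hz2

/-! ### The estimate -/

/-- STUB 3d of line `Sketch` — **(40) at the corner `z = P₄` for annealed Voronoi percolation from
Tassion's one-arm estimate F1** (Bollobás–Riordan, p. 201 and pp. 202–203, ∀-sequence form): along
every family `z_δ → d' = R.pt 3` of points of `closure Ω`, the annealed probability of a black
crossing `R.arc 0 ↔ R.arc 2` differs from `f_δ¹(z_δ)` by `o(1)`.  The registered signature. -/
theorem stub_voronoiCorner : VoronoiAnnealedOneArm →
    ∀ (PB PW : Measure (PointConfig ℂ)),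
    IsPoissonPointProcess (volume : Measure ℂ) PB → IsPoissonPointProcess (volume : Measure ℂ) PW →
    ∀ (R : ConformalRectangle) (zs : ℝ → ℂ), (∀ᶠ δ : ℝ in 𝓝[>] 0, zs δ ∈ closure R.carrier) →
      Tendsto zs (𝓝[>] 0) (𝓝 (R.pt 3)) →
      Tendsto (fun δ : ℝ => (PB.prod PW).real
            {c | voronoiCrossing R.carrier (R.arc 0) (R.arc 2) δ (c.1 : Set ℂ) (c.2 : Set ℂ)} -
          voronoiSepProb (PB.prod PW) (forgetLast R) δ 1 (zs δ)) (𝓝[>] 0) (𝓝 0) := by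
  intro hF1 PB PW hB hW R zs hzs hlim
  haveI := hB.isProbabilityMeasure
  haveI := hW.isProbabilityMeasure
  -- `R.arc 0` is at positive distance `≥ ρ` from the corner `d' = R.pt 3`
  have hd' : R.pt 3 ∉ R.arc 0 := fun h => by
    rcases R.pt_mem_arc_iff.1 h with h | h <;> exact absurd h (by decide)
  obtain ⟨ρ, hρ0, hρ⟩ := exists_pos_forall_le_dist isCompact_singleton (R.isClosed_arc 0)
    (disjoint_singleton_left.2 hd')
  have hfar : ∀ x ∈ R.arc 0, ρ ≤ dist x (R.pt 3) := fun x hx => by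
    rw [dist_comm]
    exact hρ (R.pt 3) (mem_singleton _) x hx
  have hd'cl : R.pt 3 ∈ closure R.carrier := frontier_subset_closure (R.pt_mem_frontier 3)
  rw [Metric.tendsto_nhds]
  intro β hβ
  obtain ⟨ε, ⟨hε0, -⟩, hF1ev⟩ := hF1.exists_radius hB hW (half_pos hβ) hρ0
  obtain ⟨η, hη0, hjoin⟩ := exists_joinedIn_closure_ball R.toJordanDomain hε0
  have hclose : ∀ᶠ δ : ℝ in 𝓝[>] 0, dist (zs δ) (R.pt 3) < η := Metric.tendsto_nhds.1 hlim _ hη0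
  filter_upwards [hF1ev, hzs, hclose] with δ hδ1 hδ2 hδ3
  have hτ : JoinedIn (closure R.carrier ∩ ball (R.pt 3) ε) (R.pt 3) (zs δ) :=
    hjoin (R.pt 3) hd'cl (zs δ) hδ2 (by rw [dist_comm]; exact hδ3)
  set P := PB.prod PW with hP
  set V : Set (PointConfig ℂ × PointConfig ℂ) :=
    {c | voronoiCrossing R.carrier (R.arc 0) (R.arc 2) δ (c.1 : Set ℂ) (c.2 : Set ℂ)} with hVdef
  set E : Set (PointConfig ℂ × PointConfig ℂ) :=
    {c | voronoiSepEvent (forgetLast R) δ 1 (zs δ) (c.1 : Set ℂ) (c.2 : Set ℂ)} with hEdef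
  set N : Set (PointConfig ℂ × PointConfig ℂ) :=
    {c | ∃ (a b : ℂ) (γ : Path a b), dist a (R.pt 3) ≤ ε ∧ ρ ≤ dist b (R.pt 3) ∧
      ∀ t, (γ t : ℂ) / (δ : ℂ) ∈ blackRegion (c.1 : Set ℂ) (c.2 : Set ℂ)} with hNdef
  have hVE : V ⊆ E ∪ N := fun c hc => corner_crossing_imp hfar hτ hc
  have hEV : E ⊆ V ∪ N := fun c hc => corner_sepEvent_imp hfar hτ hc
  have h1 : P.real V ≤ P.real E + P.real N :=
    (measureReal_mono hVE).trans (measureReal_union_le _ _)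
  have h2 : P.real E ≤ P.real V + P.real N :=
    (measureReal_mono hEV).trans (measureReal_union_le _ _)
  have h3 : P.real N ≤ β / 2 := hδ1 (R.pt 3)
  rw [Real.dist_eq, sub_zero]
  show |P.real V - P.real E| < β
  rw [abs_sub_lt_iff]
  constructor <;> linarith

end Summit.CriticalPhenomena.CardyFormulaZ2.Theorems.CardyFlipRussoTarget

end
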